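import Literature.Analysis.FluidPDE.SolenoidalTruncation
import HarnessLib

/-!
# Crux `ExtremiserTransience.NearExtremalTransience` (stmt-NavierStokesRegularity-21883), line `extremiser_liouville`,
# stub K1b — DENSITY LEAF, part 2: ANNULUS TAILS OF RAY AVERAGES FOR NON-`L²` FIELDS

`--supports stmt-NavierStokesRegularity-21883` (helper).  Author: prover seat `ns-el-k1b` (g2).

The density leaf of K1b truncates `V = w − c` (`w` in the stub's extended class, `c` its far-field limit,
part 1 `…ExtremiserLiouvilleFarFieldLimit`) with the tree's explicit solenoidal truncation
`Literature.Analysis.FluidPDE.solenoidalTruncation V R` (Poincaré-homotopy corrector built from the ray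
average `F = poincareField V = ∫₀¹ t V(t·) dt`).  The tree controls the truncation error when `V ∈ L²`
(`lintegral_sq_rayAverage`); here `V ∉ L²` (only `V ∈ L⁶`, `V → 0`), and the substitute inputs are:

* `tendsto_annulusMass_of_lintegral_pow_six` — for `V ∈ L⁶(ℝ³)` the scale-invariant annulus masses
  `ρ⁻² ∫_{ρ ≤ ‖x‖ ≤ 2ρ} ‖V‖²` are bounded by the antitone majorant `4·vol(B₁)^{2/3} (∫_{‖x‖≥ρ} ‖V‖⁶)^{1/3} → 0`
  (Hölder on the annulus);
* `tendsto_annulus_sq_rayAverage` — **annulus tails of the ray average**: if `ρ⁻² ∫_{A_ρ} ‖W‖² ≤ m(ρ)` with `m`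
  antitone, bounded and `m → 0`, then `R⁻² ∫_{A_R} (∫₀¹ t‖W(tx)‖dt)² dx → 0` (Cauchy–Schwarz in `t` with the
  weights `t^{1/4}·t^{3/4}`, Tonelli, the dilation `x ↦ tx`, dominated convergence — the tree's proof of
  `lintegral_sq_rayAverage` with annuli in place of exterior regions);
* `norm_poincareField_le_of_far` / `exists_forall_norm_poincareField_le` — **sup decay**: if `‖V‖ ≤ A` and
  `‖V(y)‖ ≤ ε` for `‖y‖ ≥ ρ₀` then `‖F(x)‖ ≤ ε + Aρ₀/‖x‖`; hence `sup_{‖x‖ ≥ R} ‖F‖ → 0` when `V → 0` at infinity.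

WHAT THIS IS NOT: nothing here is about Navier–Stokes solutions; the crux NET, rung N0 and NS regularity stay
OPEN — nothing here proves NS regularity. [folklore]
-/

noncomputable section

open Set Filter Topology MeasureTheory Metric Function
open scoped ENNReal NNReal Topology
open Literature.Analysis.FluidPDE

namespace Summit.NavierStokesRegularity.NavierStokesRegularity.Theorems

-- the problem directory repeats the summit name (`NavierStokesRegularity/NavierStokesRegularity`)
set_option linter.dupNamespace false

namespace ExtremiserLiouville

/-! ## Closed annuli `A_ρ = {ρ ≤ ‖x‖ ≤ 2ρ}` -/

/-- The closed annulus `{ρ ≤ ‖x‖ ≤ 2ρ}` is measurable. [folklore] -/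
theorem measurableSet_annulus (ρ : ℝ) :
    MeasurableSet {x : EuclideanSpace ℝ (Fin 3) | ρ ≤ ‖x‖ ∧ ‖x‖ ≤ 2 * ρ} :=
  ((isClosed_le continuous_const continuous_norm).inter (isClosed_le continuous_norm continuous_const)).measurableSet

/-- The volume of the annulus is at most that of the closed ball `B̄(0,2ρ)`: `8ρ³·vol(B(0,1))` for `ρ ≥ 0`.
[folklore] -/
theorem volume_annulus_le {ρ : ℝ} (hρ : 0 ≤ ρ) :
    volume {x : EuclideanSpace ℝ (Fin 3) | ρ ≤ ‖x‖ ∧ ‖x‖ ≤ 2 * ρ} ≤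
      ENNReal.ofReal ((2 * ρ) ^ 3) * volume (ball (0 : EuclideanSpace ℝ (Fin 3)) 1) := by
  calc volume {x : EuclideanSpace ℝ (Fin 3) | ρ ≤ ‖x‖ ∧ ‖x‖ ≤ 2 * ρ}
      ≤ volume (closedBall (0 : EuclideanSpace ℝ (Fin 3)) (2 * ρ)) :=
        measure_mono fun x hx => mem_closedBall_zero_iff.2 hx.2
    _ = ENNReal.ofReal ((2 * ρ) ^ 3) * volume (ball (0 : EuclideanSpace ℝ (Fin 3)) 1) := by
        rw [Measure.addHaar_closedBall volume (0 : EuclideanSpace ℝ (Fin 3)) (by positivity : 0 ≤ 2 * ρ),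
          finrank_euclideanSpace_fin]

/-! ## Annulus masses of an `L⁶` field -/

/-- **Hölder on the annulus**: `ρ⁻² ∫_{A_ρ} ‖V‖² ≤ 4 vol(B₁)^{2/3} (∫_{‖x‖ ≥ ρ} ‖V‖⁶)^{1/3}` for `ρ > 0` and a
continuous field `V`. [folklore] -/
theorem annulusMass_le_tail_pow_six {V : EuclideanSpace ℝ (Fin 3) → EuclideanSpace ℝ (Fin 3)} (hVc : Continuous V)
    {ρ : ℝ} (hρ : 0 < ρ) :
    ENNReal.ofReal ((ρ ^ 2)⁻¹) * ∫⁻ x in {x : EuclideanSpace ℝ (Fin 3) | ρ ≤ ‖x‖ ∧ ‖x‖ ≤ 2 * ρ}, ‖V x‖ₑ ^ 2 ≤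
      4 * volume (ball (0 : EuclideanSpace ℝ (Fin 3)) 1) ^ (2 / 3 : ℝ) *
        (∫⁻ x in {x : EuclideanSpace ℝ (Fin 3) | ρ ≤ ‖x‖}, ‖V x‖ₑ ^ 6) ^ (1 / 3 : ℝ) := by
  set A := {x : EuclideanSpace ℝ (Fin 3) | ρ ≤ ‖x‖ ∧ ‖x‖ ≤ 2 * ρ} with hA
  have hAm : MeasurableSet A := measurableSet_annulus ρ
  -- Hölder with exponents `3` and `3/2` on the restricted measure
  have hpq : Real.HolderConjugate 3 (3 / 2) := by
    rw [Real.holderConjugate_iff]; norm_num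
  have hf : AEMeasurable (fun x => ‖V x‖ₑ ^ 2) (volume.restrict A) :=
    (hVc.measurable.enorm.pow_const _).aemeasurable
  have hg : AEMeasurable (fun _ : EuclideanSpace ℝ (Fin 3) => (1 : ℝ≥0∞)) (volume.restrict A) :=
    aemeasurable_const
  have hH := ENNReal.lintegral_mul_le_Lp_mul_Lq (volume.restrict A) hpq hf hg
  simp only [Pi.mul_apply, mul_one, ENNReal.one_rpow, lintegral_const, Measure.restrict_apply MeasurableSet.univ,
    univ_inter, one_mul] at hH
  -- `(‖V‖ₑ²)³ = ‖V‖ₑ⁶`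
  have h6 : ∫⁻ x in A, (‖V x‖ₑ ^ 2) ^ (3 : ℝ) = ∫⁻ x in A, ‖V x‖ₑ ^ 6 := by
    refine lintegral_congr fun x => ?_
    rw [show (3 : ℝ) = ((3 : ℕ) : ℝ) by norm_num, ENNReal.rpow_natCast, ← pow_mul]
  rw [h6] at hH
  -- the volume factor
  have hvol : volume A ^ (1 / (3 / 2 : ℝ)) ≤
      ENNReal.ofReal (4 * ρ ^ 2) * volume (ball (0 : EuclideanSpace ℝ (Fin 3)) 1) ^ (2 / 3 : ℝ) := by
    have h1 : (1 / (3 / 2 : ℝ)) = 2 / 3 := by norm_num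
    rw [h1]
    calc volume A ^ (2 / 3 : ℝ)
        ≤ (ENNReal.ofReal ((2 * ρ) ^ 3) * volume (ball (0 : EuclideanSpace ℝ (Fin 3)) 1)) ^ (2 / 3 : ℝ) :=
          ENNReal.rpow_le_rpow (volume_annulus_le hρ.le) (by norm_num)
      _ = ENNReal.ofReal ((2 * ρ) ^ 3) ^ (2 / 3 : ℝ) *
            volume (ball (0 : EuclideanSpace ℝ (Fin 3)) 1) ^ (2 / 3 : ℝ) :=
          ENNReal.mul_rpow_of_nonneg _ _ (by norm_num)
      _ = ENNReal.ofReal (4 * ρ ^ 2) * volume (ball (0 : EuclideanSpace ℝ (Fin 3)) 1) ^ (2 / 3 : ℝ) := by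
          congr 1
          rw [ENNReal.ofReal_rpow_of_nonneg (by positivity) (by norm_num)]
          congr 1
          rw [show (2 * ρ) ^ 3 = (2 * ρ) ^ (3 : ℝ) by norm_cast, ← Real.rpow_mul (by positivity)]
          norm_num
          ring
  -- the tail dominates the annulus
  have htail : (∫⁻ x in A, ‖V x‖ₑ ^ 6) ^ (1 / 3 : ℝ) ≤
      (∫⁻ x in {x : EuclideanSpace ℝ (Fin 3) | ρ ≤ ‖x‖}, ‖V x‖ₑ ^ 6) ^ (1 / 3 : ℝ) :=
    ENNReal.rpow_le_rpow (lintegral_mono_set fun x hx => hx.1) (by norm_num)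
  calc ENNReal.ofReal ((ρ ^ 2)⁻¹) * ∫⁻ x in A, ‖V x‖ₑ ^ 2
      ≤ ENNReal.ofReal ((ρ ^ 2)⁻¹) * ((∫⁻ x in A, ‖V x‖ₑ ^ 6) ^ (1 / (3 : ℝ)) * volume A ^ (1 / (3 / 2 : ℝ))) := by
        gcongr
    _ ≤ ENNReal.ofReal ((ρ ^ 2)⁻¹) * ((∫⁻ x in {x : EuclideanSpace ℝ (Fin 3) | ρ ≤ ‖x‖}, ‖V x‖ₑ ^ 6) ^ (1 / 3 : ℝ) *
          (ENNReal.ofReal (4 * ρ ^ 2) * volume (ball (0 : EuclideanSpace ℝ (Fin 3)) 1) ^ (2 / 3 : ℝ))) := by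
        gcongr
    _ = (ENNReal.ofReal ((ρ ^ 2)⁻¹) * ENNReal.ofReal (4 * ρ ^ 2)) *
          volume (ball (0 : EuclideanSpace ℝ (Fin 3)) 1) ^ (2 / 3 : ℝ) *
          (∫⁻ x in {x : EuclideanSpace ℝ (Fin 3) | ρ ≤ ‖x‖}, ‖V x‖ₑ ^ 6) ^ (1 / 3 : ℝ) := by ring
    _ = 4 * volume (ball (0 : EuclideanSpace ℝ (Fin 3)) 1) ^ (2 / 3 : ℝ) *
          (∫⁻ x in {x : EuclideanSpace ℝ (Fin 3) | ρ ≤ ‖x‖}, ‖V x‖ₑ ^ 6) ^ (1 / 3 : ℝ) := by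
        rw [← ENNReal.ofReal_mul (by positivity)]
        have : (ρ ^ 2)⁻¹ * (4 * ρ ^ 2) = 4 := by field_simp
        rw [this]
        norm_num

/-- **The annulus masses of an `L⁶` field vanish at infinity, with an antitone majorant.**  For a continuous
`V : ℝ³ → ℝ³` with `∫ ‖V‖⁶ < ∞` the function `m(ρ) = 4 vol(B₁)^{2/3} (∫_{‖x‖≥ρ} ‖V‖⁶)^{1/3}` is antitone, finite,
tends to `0`, and dominates `ρ⁻² ∫_{ρ ≤ ‖x‖ ≤ 2ρ} ‖V‖²` for every `ρ > 0`. [folklore] -/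
theorem tendsto_annulusMass_of_lintegral_pow_six {V : EuclideanSpace ℝ (Fin 3) → EuclideanSpace ℝ (Fin 3)}
    (hVc : Continuous V) (hV6 : ∫⁻ x, ‖V x‖ₑ ^ 6 < ⊤) :
    ∃ m : ℝ → ℝ≥0∞, Antitone m ∧ (∃ Q : ℝ≥0∞, Q < ⊤ ∧ ∀ ρ, m ρ ≤ Q) ∧ Tendsto m atTop (𝓝 0) ∧
      ∀ ρ : ℝ, 0 < ρ →
        ENNReal.ofReal ((ρ ^ 2)⁻¹) * ∫⁻ x in {x : EuclideanSpace ℝ (Fin 3) | ρ ≤ ‖x‖ ∧ ‖x‖ ≤ 2 * ρ}, ‖V x‖ₑ ^ 2 ≤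
          m ρ := by
  set K : ℝ≥0∞ := 4 * volume (ball (0 : EuclideanSpace ℝ (Fin 3)) 1) ^ (2 / 3 : ℝ) with hK
  have hKtop : K < ⊤ := ENNReal.mul_lt_top (by norm_num)
    (ENNReal.rpow_lt_top_of_nonneg (by norm_num) measure_ball_lt_top.ne)
  set tail : ℝ → ℝ≥0∞ := fun ρ => ∫⁻ x in {x : EuclideanSpace ℝ (Fin 3) | ρ ≤ ‖x‖}, ‖V x‖ₑ ^ 6 with htail
  have hanti : Antitone tail := antitone_setLIntegral_norm_ge _
  have hle : ∀ ρ, tail ρ ≤ ∫⁻ x, ‖V x‖ₑ ^ 6 := fun ρ => setLIntegral_le_lintegral _ _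
  have htend : Tendsto tail atTop (𝓝 0) :=
    tendsto_setLIntegral_norm_ge (hVc.measurable.enorm.pow_const _) hV6.ne
  refine ⟨fun ρ => K * tail ρ ^ (1 / 3 : ℝ), ?_, ⟨K * (∫⁻ x, ‖V x‖ₑ ^ 6) ^ (1 / 3 : ℝ), ?_, ?_⟩, ?_, ?_⟩
  · intro a b hab
    exact mul_le_mul_right (ENNReal.rpow_le_rpow (hanti hab) (by norm_num)) K
  · exact ENNReal.mul_lt_top hKtop (ENNReal.rpow_lt_top_of_nonneg (by norm_num) hV6.ne)
  · intro ρ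
    exact mul_le_mul_right (ENNReal.rpow_le_rpow (hle ρ) (by norm_num)) K
  · have h1 : Tendsto (fun ρ => tail ρ ^ (1 / 3 : ℝ)) atTop (𝓝 0) := by
      have hc := (ENNReal.continuous_rpow_const (y := (1 / 3 : ℝ))).tendsto (0 : ℝ≥0∞)
      rw [ENNReal.zero_rpow_of_pos (by norm_num : (0 : ℝ) < 1 / 3)] at hc
      exact hc.comp htend
    simpa using ENNReal.Tendsto.const_mul h1 (Or.inr hKtop.ne)
  · intro ρ hρ
    exact annulusMass_le_tail_pow_six hVc hρ

/-! ## Annulus tails of the ray average `∫₀¹ t ‖W(tx)‖ dt` -/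

/-- Dilation of an annulus integral: `∫_{A_R} G(t x) dx = t⁻³ ∫_{A_{tR}} G` for `t > 0`. [folklore] -/
theorem lintegral_annulus_comp_smul (G : EuclideanSpace ℝ (Fin 3) → ℝ≥0∞) {t : ℝ} (ht : 0 < t) (R : ℝ) :
    ∫⁻ x in {x : EuclideanSpace ℝ (Fin 3) | R ≤ ‖x‖ ∧ ‖x‖ ≤ 2 * R}, G (t • x) =
      ENNReal.ofReal ((t ^ 3)⁻¹) * ∫⁻ y in {y : EuclideanSpace ℝ (Fin 3) | t * R ≤ ‖y‖ ∧ ‖y‖ ≤ 2 * (t * R)}, G y := by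
  set H : EuclideanSpace ℝ (Fin 3) → ℝ≥0∞ :=
    {y : EuclideanSpace ℝ (Fin 3) | t * R ≤ ‖y‖ ∧ ‖y‖ ≤ 2 * (t * R)}.indicator G with hH
  have hHt : ∀ x, H (t • x) = {x : EuclideanSpace ℝ (Fin 3) | R ≤ ‖x‖ ∧ ‖x‖ ≤ 2 * R}.indicator (fun x => G (t • x)) x := by
    intro x
    have hiff : t • x ∈ {y : EuclideanSpace ℝ (Fin 3) | t * R ≤ ‖y‖ ∧ ‖y‖ ≤ 2 * (t * R)} ↔
        x ∈ {x : EuclideanSpace ℝ (Fin 3) | R ≤ ‖x‖ ∧ ‖x‖ ≤ 2 * R} := by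
      simp only [mem_setOf_eq, norm_smul, Real.norm_of_nonneg ht.le]
      constructor
      · rintro ⟨h1, h2⟩
        exact ⟨le_of_mul_le_mul_left h1 ht, le_of_mul_le_mul_left (by linarith) ht⟩
      · rintro ⟨h1, h2⟩
        exact ⟨mul_le_mul_of_nonneg_left h1 ht.le, by nlinarith⟩
    by_cases hx : x ∈ {x : EuclideanSpace ℝ (Fin 3) | R ≤ ‖x‖ ∧ ‖x‖ ≤ 2 * R}
    · rw [hH, indicator_of_mem (hiff.2 hx), indicator_of_mem hx]
    · rw [hH, indicator_of_notMem (fun h => hx (hiff.1 h)), indicator_of_notMem hx]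
  rw [← lintegral_indicator (measurableSet_annulus R), ← lintegral_indicator (measurableSet_annulus (t * R))]
  simp_rw [← hHt]
  rw [lintegral_comp_smul H ht.ne', finrank_euclideanSpace_fin, abs_of_nonneg (inv_nonneg.2 (pow_nonneg ht.le 3))]

/-- **Annulus tails of the ray average.**  Let `W : ℝ³ → F'` be continuous and suppose the scale-invariant
annulus masses are dominated, `R⁻² ∫_{R ≤ ‖x‖ ≤ 2R} ‖W‖² ≤ m(R)` (`R > 0`), by an antitone, bounded `m` with
`m(ρ) → 0`.  Then for the ray average `I(x) = ∫₀¹ t ‖W(tx)‖ dt` (which dominates the Poincaré field of `W`):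
`R⁻² ∫_{R ≤ ‖x‖ ≤ 2R} I(x)² dx → 0` as `R → ∞`.  Proof: Cauchy–Schwarz in `t` (`t = t^{1/4}·t^{3/4}`), Tonelli,
the dilation `x ↦ tx` (`R⁻² t^{3/2} t⁻³ = t^{1/2}·(tR)⁻²`), and dominated convergence in `t`. [folklore] -/
theorem tendsto_annulus_sq_rayAverage {F' : Type*} [NormedAddCommGroup F'] {W : EuclideanSpace ℝ (Fin 3) → F'}
    (hW : Continuous W) {m : ℝ → ℝ≥0∞} (hm_anti : Antitone m) {Q : ℝ≥0∞} (hQ : Q < ⊤) (hm_le : ∀ ρ, m ρ ≤ Q)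
    (hm_tend : Tendsto m atTop (𝓝 0))
    (hmass : ∀ ρ : ℝ, 0 < ρ →
      ENNReal.ofReal ((ρ ^ 2)⁻¹) * ∫⁻ x in {x : EuclideanSpace ℝ (Fin 3) | ρ ≤ ‖x‖ ∧ ‖x‖ ≤ 2 * ρ}, ‖W x‖ₑ ^ 2 ≤ m ρ) :
    Tendsto (fun R : ℝ => ENNReal.ofReal ((R ^ 2)⁻¹) *
      ∫⁻ x in {x : EuclideanSpace ℝ (Fin 3) | R ≤ ‖x‖ ∧ ‖x‖ ≤ 2 * R},
        (∫⁻ t in Ioo (0 : ℝ) 1, ENNReal.ofReal (t ^ 1) * ‖W (t • x)‖ₑ) ^ 2) atTop (𝓝 0) := by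
  -- notation
  set C₀ : ℝ≥0∞ := ∫⁻ t in Ioo (0 : ℝ) 1, ENNReal.ofReal (t ^ (1 / 2 : ℝ)) with hC₀
  have hC₀fin : C₀ < ⊤ := by
    refine (setLIntegral_lt_top_of_le_nnreal (measure_Ioo_lt_top.ne) ⟨1, fun t ht => ?_⟩)
    rw [ENNReal.coe_one, ← ENNReal.ofReal_one]
    exact ENNReal.ofReal_le_ofReal (Real.rpow_le_one ht.1.le ht.2.le (by norm_num))
  set I : EuclideanSpace ℝ (Fin 3) → ℝ≥0∞ := fun x =>
    ∫⁻ t in Ioo (0 : ℝ) 1, ENNReal.ofReal (t ^ 1) * ‖W (t • x)‖ₑ with hI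
  set J : EuclideanSpace ℝ (Fin 3) → ℝ≥0∞ := fun x => ∫⁻ t in Ioo (0 : ℝ) 1,
    ENNReal.ofReal (t ^ (3 / 2 : ℝ)) * ‖W (t • x)‖ₑ ^ 2 with hJ
  -- joint measurability
  have hWc : Continuous fun p : EuclideanSpace ℝ (Fin 3) × ℝ => W (p.2 • p.1) :=
    hW.comp (continuous_snd.smul continuous_fst)
  have hJmeas : Measurable (uncurry fun (x : EuclideanSpace ℝ (Fin 3)) (t : ℝ) =>
      ENNReal.ofReal (t ^ (3 / 2 : ℝ)) * ‖W (t • x)‖ₑ ^ 2) := by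
    refine Measurable.mul ?_ (hWc.enorm.measurable.pow_const _)
    exact ENNReal.measurable_ofReal.comp (measurable_snd.pow_const _)
  -- Step 1: Cauchy–Schwarz in `t`
  have hCS : ∀ x, I x ^ 2 ≤ C₀ * J x := by
    intro x
    have hf : AEMeasurable (fun t : ℝ => ENNReal.ofReal (t ^ (1 / 4 : ℝ))) (volume.restrict (Ioo (0 : ℝ) 1)) :=
      (ENNReal.measurable_ofReal.comp (measurable_id.pow_const _)).aemeasurable
    have hg : AEMeasurable (fun t : ℝ => ENNReal.ofReal (t ^ (3 / 4 : ℝ)) * ‖W (t • x)‖ₑ)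
        (volume.restrict (Ioo (0 : ℝ) 1)) :=
      ((ENNReal.measurable_ofReal.comp (measurable_id.pow_const _)).mul
        (hW.comp (continuous_id.smul continuous_const)).enorm.measurable).aemeasurable
    have h := lintegral_mul_sq_le hf hg
    have hIeq : I x = ∫⁻ t in Ioo (0 : ℝ) 1, ENNReal.ofReal (t ^ (1 / 4 : ℝ)) *
        (ENNReal.ofReal (t ^ (3 / 4 : ℝ)) * ‖W (t • x)‖ₑ) := by
      refine setLIntegral_congr_fun measurableSet_Ioo fun t ht => ?_
      rw [← mul_assoc, ← ENNReal.ofReal_mul (Real.rpow_nonneg ht.1.le _), ← Real.rpow_add ht.1, pow_one]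
      norm_num
    have hfeq : ∫⁻ t in Ioo (0 : ℝ) 1, ENNReal.ofReal (t ^ (1 / 4 : ℝ)) ^ 2 = C₀ := by
      refine setLIntegral_congr_fun measurableSet_Ioo fun t ht => ?_
      rw [← ENNReal.ofReal_pow (Real.rpow_nonneg ht.1.le _), ← Real.rpow_natCast,
        ← Real.rpow_mul ht.1.le]
      norm_num
    have hgeq : ∫⁻ t in Ioo (0 : ℝ) 1, (ENNReal.ofReal (t ^ (3 / 4 : ℝ)) * ‖W (t • x)‖ₑ) ^ 2 = J x := by
      refine setLIntegral_congr_fun measurableSet_Ioo fun t ht => ?_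
      rw [mul_pow, ← ENNReal.ofReal_pow (Real.rpow_nonneg ht.1.le _), ← Real.rpow_natCast,
        ← Real.rpow_mul ht.1.le]
      norm_num
    rw [hIeq, ← hfeq, ← hgeq]
    exact h
  -- Step 2: the scaled annulus identity, for `t ∈ (0,1)`
  have hscale : ∀ R : ℝ, 0 < R → ∀ t ∈ Ioo (0 : ℝ) 1,
      ENNReal.ofReal ((R ^ 2)⁻¹) * (ENNReal.ofReal (t ^ (3 / 2 : ℝ)) *
        ∫⁻ x in {x : EuclideanSpace ℝ (Fin 3) | R ≤ ‖x‖ ∧ ‖x‖ ≤ 2 * R}, ‖W (t • x)‖ₑ ^ 2) ≤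
        ENNReal.ofReal (t ^ (1 / 2 : ℝ)) * m (t * R) := by
    intro R hR t ht
    have htpos : 0 < t := ht.1
    rw [lintegral_annulus_comp_smul (fun y => ‖W y‖ₑ ^ 2) htpos R]
    have hkey : ENNReal.ofReal ((R ^ 2)⁻¹) * (ENNReal.ofReal (t ^ (3 / 2 : ℝ)) * ENNReal.ofReal ((t ^ 3)⁻¹)) =
        ENNReal.ofReal (t ^ (1 / 2 : ℝ)) * ENNReal.ofReal (((t * R) ^ 2)⁻¹) := by
      rw [← ENNReal.ofReal_mul (Real.rpow_nonneg htpos.le _), ← ENNReal.ofReal_mul (by positivity),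
        ← ENNReal.ofReal_mul (Real.rpow_nonneg htpos.le _)]
      congr 1
      have e : t ^ (3 / 2 : ℝ) = t ^ (1 / 2 : ℝ) * t := by
        rw [show (3 / 2 : ℝ) = 1 / 2 + 1 by norm_num, Real.rpow_add htpos, Real.rpow_one]
      rw [e]
      field_simp
    calc ENNReal.ofReal ((R ^ 2)⁻¹) * (ENNReal.ofReal (t ^ (3 / 2 : ℝ)) * (ENNReal.ofReal ((t ^ 3)⁻¹) *
          ∫⁻ y in {y : EuclideanSpace ℝ (Fin 3) | t * R ≤ ‖y‖ ∧ ‖y‖ ≤ 2 * (t * R)}, ‖W y‖ₑ ^ 2))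
        = (ENNReal.ofReal ((R ^ 2)⁻¹) * (ENNReal.ofReal (t ^ (3 / 2 : ℝ)) * ENNReal.ofReal ((t ^ 3)⁻¹))) *
          ∫⁻ y in {y : EuclideanSpace ℝ (Fin 3) | t * R ≤ ‖y‖ ∧ ‖y‖ ≤ 2 * (t * R)}, ‖W y‖ₑ ^ 2 := by ring
      _ = ENNReal.ofReal (t ^ (1 / 2 : ℝ)) * (ENNReal.ofReal (((t * R) ^ 2)⁻¹) *
          ∫⁻ y in {y : EuclideanSpace ℝ (Fin 3) | t * R ≤ ‖y‖ ∧ ‖y‖ ≤ 2 * (t * R)}, ‖W y‖ₑ ^ 2) := by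
          rw [hkey, mul_assoc]
      _ ≤ ENNReal.ofReal (t ^ (1 / 2 : ℝ)) * m (t * R) := by
          gcongr
          exact hmass (t * R) (by positivity)
  -- Step 3: the annulus bound
  have hbound : ∀ R : ℝ, 0 < R → ENNReal.ofReal ((R ^ 2)⁻¹) *
      ∫⁻ x in {x : EuclideanSpace ℝ (Fin 3) | R ≤ ‖x‖ ∧ ‖x‖ ≤ 2 * R}, I x ^ 2 ≤
        C₀ * ∫⁻ t in Ioo (0 : ℝ) 1, m (t * R) := by
    intro R hR
    set A := {x : EuclideanSpace ℝ (Fin 3) | R ≤ ‖x‖ ∧ ‖x‖ ≤ 2 * R} with hA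
    calc ENNReal.ofReal ((R ^ 2)⁻¹) * ∫⁻ x in A, I x ^ 2
        ≤ ENNReal.ofReal ((R ^ 2)⁻¹) * ∫⁻ x in A, C₀ * J x :=
          mul_le_mul' le_rfl (lintegral_mono fun x => hCS x)
      _ = C₀ * (ENNReal.ofReal ((R ^ 2)⁻¹) * ∫⁻ x in A, J x) := by
          rw [lintegral_const_mul' _ _ hC₀fin.ne]; ring
      _ = C₀ * (ENNReal.ofReal ((R ^ 2)⁻¹) * ∫⁻ t in Ioo (0 : ℝ) 1, ∫⁻ x in A,
            ENNReal.ofReal (t ^ (3 / 2 : ℝ)) * ‖W (t • x)‖ₑ ^ 2) := by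
          congr 2
          exact lintegral_lintegral_swap (hJmeas.aemeasurable.mono_measure
            (Measure.prod_mono Measure.restrict_le_self Measure.restrict_le_self))
      _ = C₀ * ∫⁻ t in Ioo (0 : ℝ) 1, ENNReal.ofReal ((R ^ 2)⁻¹) * (ENNReal.ofReal (t ^ (3 / 2 : ℝ)) *
            ∫⁻ x in A, ‖W (t • x)‖ₑ ^ 2) := by
          congr 1
          rw [← lintegral_const_mul' _ _ ENNReal.ofReal_ne_top]
          refine setLIntegral_congr_fun measurableSet_Ioo fun t ht => ?_
          rw [lintegral_const_mul' _ _ ENNReal.ofReal_ne_top]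
      _ ≤ C₀ * ∫⁻ t in Ioo (0 : ℝ) 1, ENNReal.ofReal (t ^ (1 / 2 : ℝ)) * m (t * R) := by
          gcongr C₀ * ?_
          exact setLIntegral_mono' measurableSet_Ioo fun t ht => hscale R hR t ht
      _ ≤ C₀ * ∫⁻ t in Ioo (0 : ℝ) 1, m (t * R) := by
          gcongr C₀ * ?_
          refine setLIntegral_mono' measurableSet_Ioo fun t ht => ?_
          calc ENNReal.ofReal (t ^ (1 / 2 : ℝ)) * m (t * R) ≤ 1 * m (t * R) := by
                gcongr
                rw [← ENNReal.ofReal_one]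
                exact ENNReal.ofReal_le_ofReal (Real.rpow_le_one ht.1.le ht.2.le (by norm_num))
            _ = m (t * R) := one_mul _
  -- Step 4: dominated convergence in `t`
  have hlim : Tendsto (fun R : ℝ => ∫⁻ t in Ioo (0 : ℝ) 1, m (t * R)) atTop (𝓝 0) := by
    have h0 : (0 : ℝ≥0∞) = ∫⁻ _ in Ioo (0 : ℝ) 1, 0 := by simp
    rw [h0]
    refine tendsto_lintegral_filter_of_dominated_convergence (fun _ => Q) ?_ ?_ ?_ ?_
    · filter_upwards [eventually_ge_atTop (0 : ℝ)] with R hR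
      have hanti : Antitone fun t : ℝ => m (t * R) := fun a b hab =>
        hm_anti (mul_le_mul_of_nonneg_right hab hR)
      exact hanti.measurable
    · exact Eventually.of_forall fun R => Eventually.of_forall fun t => hm_le _
    · rw [setLIntegral_const]
      exact (ENNReal.mul_lt_top hQ measure_Ioo_lt_top).ne
    · refine (ae_restrict_iff' measurableSet_Ioo).2 (Eventually.of_forall fun t ht => ?_)
      exact hm_tend.comp (tendsto_id.const_mul_atTop ht.1)
  have hlim' : Tendsto (fun R : ℝ => C₀ * ∫⁻ t in Ioo (0 : ℝ) 1, m (t * R)) atTop (𝓝 0) := by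
    simpa using ENNReal.Tendsto.const_mul hlim (Or.inr hC₀fin.ne)
  refine tendsto_of_tendsto_of_tendsto_of_le_of_le' tendsto_const_nhds hlim' ?_ ?_
  · exact Eventually.of_forall fun _ => zero_le
  · filter_upwards [eventually_gt_atTop (0 : ℝ)] with R hR using hbound R hR

/-! ## Sup decay of the Poincaré field of a field vanishing at infinity -/

/-- **Pointwise decay of the Poincaré field.**  If `‖V‖ ≤ A` everywhere and `‖V(y)‖ ≤ ε` for `‖y‖ ≥ ρ₀ > 0`,
then `‖poincareField V x‖ ≤ ε + A ρ₀ / ‖x‖` for `x ≠ 0` (on the ray, `t‖V(tx)‖ ≤ tA ≤ Aρ₀/‖x‖` while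
`t‖x‖ < ρ₀`, and `≤ ε` beyond). [folklore] -/
theorem norm_poincareField_le_of_far {V : EuclideanSpace ℝ (Fin 3) → EuclideanSpace ℝ (Fin 3)} {A ε ρ₀ : ℝ}
    (hA : ∀ y, ‖V y‖ ≤ A) (hε : 0 ≤ ε) (hρ₀ : 0 < ρ₀) (hfar : ∀ y, ρ₀ ≤ ‖y‖ → ‖V y‖ ≤ ε)
    {x : EuclideanSpace ℝ (Fin 3)} (hx : x ≠ 0) :
    ‖poincareField V x‖ ≤ ε + A * ρ₀ / ‖x‖ := by
  have hA0 : 0 ≤ A := (norm_nonneg _).trans (hA 0)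
  have hxpos : 0 < ‖x‖ := norm_pos_iff.2 hx
  rw [poincareField_apply]
  have hb : ∀ t ∈ Set.uIoc (0 : ℝ) 1, ‖t • V (t • x)‖ ≤ ε + A * ρ₀ / ‖x‖ := by
    intro t ht
    rw [uIoc_of_le zero_le_one] at ht
    have ht0 : 0 ≤ t := ht.1.le
    rw [norm_smul, Real.norm_of_nonneg ht0]
    by_cases hcase : ρ₀ ≤ t * ‖x‖
    · -- far: `‖V(tx)‖ ≤ ε`
      have h1 : ‖V (t • x)‖ ≤ ε := hfar _ (by rwa [norm_smul, Real.norm_of_nonneg ht0])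
      calc t * ‖V (t • x)‖ ≤ 1 * ε := mul_le_mul ht.2 h1 (norm_nonneg _) zero_le_one
        _ = ε := one_mul ε
        _ ≤ ε + A * ρ₀ / ‖x‖ := le_add_of_nonneg_right (by positivity)
    · -- near: `t ≤ ρ₀/‖x‖`
      rw [not_le] at hcase
      have ht' : t ≤ ρ₀ / ‖x‖ := by rw [le_div_iff₀ hxpos]; exact hcase.le
      calc t * ‖V (t • x)‖ ≤ (ρ₀ / ‖x‖) * A := mul_le_mul ht' (hA _) (norm_nonneg _) (by positivity)
        _ = A * ρ₀ / ‖x‖ := by ring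
        _ ≤ ε + A * ρ₀ / ‖x‖ := le_add_of_nonneg_left hε
  have h := intervalIntegral.norm_integral_le_of_norm_le_const hb
  simpa using h

/-- **Uniform smallness of the Poincaré field far out.**  If `V` is bounded and `V → 0` at infinity then for
every `δ > 0` there is `R₀ > 0` with `‖poincareField V x‖ ≤ δ` whenever `‖x‖ ≥ R₀`. [folklore] -/
theorem exists_forall_norm_poincareField_le {V : EuclideanSpace ℝ (Fin 3) → EuclideanSpace ℝ (Fin 3)} {A : ℝ}
    (hA : ∀ y, ‖V y‖ ≤ A) (hdec : Tendsto V (cocompact (EuclideanSpace ℝ (Fin 3))) (𝓝 0)) {δ : ℝ}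
    (hδ : 0 < δ) :
    ∃ R₀ : ℝ, 0 < R₀ ∧ ∀ x : EuclideanSpace ℝ (Fin 3), R₀ ≤ ‖x‖ → ‖poincareField V x‖ ≤ δ := by
  have hA0 : 0 ≤ A := (norm_nonneg _).trans (hA 0)
  -- `‖V y‖ ≤ δ/2` beyond some radius `ρ₀`
  have hev : ∀ᶠ y in cocompact (EuclideanSpace ℝ (Fin 3)), ‖V y‖ ≤ δ / 2 :=
    (tendsto_zero_iff_norm_tendsto_zero.1 hdec).eventually (Iic_mem_nhds (by positivity : (0:ℝ) < δ / 2))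
  obtain ⟨K, hK, hKsub⟩ := mem_cocompact.1 hev
  obtain ⟨ρ, hρ⟩ := hK.isBounded.subset_closedBall (0 : EuclideanSpace ℝ (Fin 3))
  set ρ₀ : ℝ := max ρ 0 + 1 with hρ₀
  have hρ₀pos : 0 < ρ₀ := by rw [hρ₀]; positivity
  have hfar : ∀ y : EuclideanSpace ℝ (Fin 3), ρ₀ ≤ ‖y‖ → ‖V y‖ ≤ δ / 2 := by
    intro y hy
    have hyK : y ∉ K := by
      intro h
      have := mem_closedBall_zero_iff.1 (hρ h)
      have : ρ < ρ₀ := by rw [hρ₀]; linarith [le_max_left ρ 0]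
      linarith
    exact hKsub hyK
  -- beyond `R₀ = max 1 (2Aρ₀/δ)` the Poincaré field is `≤ δ`
  refine ⟨max 1 (2 * A * ρ₀ / δ), lt_of_lt_of_le one_pos (le_max_left _ _), fun x hx => ?_⟩
  have hxpos : 0 < ‖x‖ := lt_of_lt_of_le one_pos ((le_max_left _ _).trans hx)
  have hx0 : x ≠ 0 := norm_pos_iff.1 hxpos
  have h := norm_poincareField_le_of_far hA (by positivity : (0:ℝ) ≤ δ / 2) hρ₀pos hfar hx0
  have h2 : A * ρ₀ / ‖x‖ ≤ δ / 2 := by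
    rw [div_le_iff₀ hxpos]
    have : 2 * A * ρ₀ / δ ≤ ‖x‖ := (le_max_right _ _).trans hx
    rw [div_le_iff₀ hδ] at this
    linarith
  linarith

end ExtremiserLiouville

end Summit.NavierStokesRegularity.NavierStokesRegularity.Theorems

end
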